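import Literature.NumberTheory.EllipticCurves.AnticyclotomicSignedCompactSelmer
import Literature.NumberTheory.EllipticCurves.LambdaAdicSelmerDataTorsionFreeProofs
import HarnessLib

/-!
# The compact signed Selmer modules `Sel^{𝓛}(K, 𝐓^ac) = lim←_n Sel^{𝓛}(K_n, T)` are `Λ^ac`-TORSION-FREE
# when `E(K_n)[p] = 0` along the tower (proofs file; Shapiro-free, levelwise)

Topic `NumberTheory/EllipticCurves`; namespace `Literature.NumberTheory.EllipticCurves.AcSigned` (the object
namespace of `AnticyclotomicSignedSelmer.lean` / `AnticyclotomicSignedCompactSelmer.lean`). THEOREMS ONLY (no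
definition, no named fact, no `sorry`, no instance, no notation). Written by the lead prover seat
`bsd-line-sbc-p1` (gen 9) of the BSD summit's route `SignedBaseChange`, `--supports` the crux
stmt-BirchSwinnertonDyer-20727 `AnticyclotomicEisensteinDivisibility` (line `bdpline`): the FIRST field
`torsionFree` of the hypothesis structure `AcSigned.TransferInputs` (file `AnticyclotomicSignedTransferInputs`;
Castella–Wan 2024, proof of Thm. 6.8, MS p. 30: "`E(K)[p] = 0` … hence `E(K_∞)[p^∞] = 0`, which by
[PR00, §1.3.3] implies that the `Λ^ac`-torsion submodule of `H¹(K, 𝐓^ac)` is trivial") — a conjunct of the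
typed named fact `AcSigned.castellaWan2024_proofThm68_transferInputs` (conjunct 3 of the crux's stub
`stub_namedFactsSS`) — is PROVED here, for every family of local conditions `𝓛`, on the tree's own carriers.

WHAT. For `W` a Weierstrass curve over a field `K`, `κ` a `ℤ_p`-extension of `K` with topological generator
`γ` (`κ.IsTopGenerator γ`), level conditions `C n m ≤ H¹(K_n, E[p^m])` stable under `conj_γ`, and the tree's
`Λ`-adic carrier `lambdaAdic W p κ γ C ⊆ ∏_n ∏_m H¹(K_n, E[p^m])` (norm-compatible, `p_*`-compatible families;
`Λ = ℤ_p⟦X⟧` acting through `lambdaAdic.moduleOfGen`, `X ↦ conj_γ − 1`), UNDER THE HYPOTHESIS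
`E(K_n)[p] = 0` for every layer `n` (`hE : ∀ n P, (∀ σ ∈ Gal(K̄/K_n), σ • P = P) → p • P = 0 → P = 0`):
* §1 `geomTorsion_eq_zero_of_forall_layer_fixed` — then `E[p^k]^{Gal(K̄/K_n)} = 0` for all `k`, so
  restriction `H¹(K_n, E[p^k]) → H¹(K_{n'}, E[p^k])` is injective along the tower
  (`resOfLe_layer_injective_of_forall_layer_fixed`, by the tree's inflation–restriction
  `resOfLe_injective_of_forall_fixed_eq_zero`).
* §2 `lambdaAdic.one_add_X_pow_smul_apply` (`(1+X)^i` acts levelwise as `conj_{γ^i}`),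
  `lambdaAdic.resPi_eq_sum_conjPi` (universal norms: `res_{K_k→K_{k+n}} x_k = Σ_{i<pⁿ} conj_{γ^{p^k i}} x_{k+n}`,
  the `n`-fold iterate of the carrier's norm compatibility), `lambdaAdic.geom_sum_smul_apply_eq_resPi`
  (`(ν_{n,k} • x)_{n+k} = res x_n`, `ν_{n,k} = Σ_{i<p^k} (1+X)^{p^n i}`).
* §3 `lambdaAdic.eq_zero_of_pow_natCast_smul_eq_zero` — the `p`-part `(p : Λ)^c • x = 0 ⇒ x = 0`
  (levelwise `eq_zero_of_pow_zsmul_eq_zero_of_reduce_eq`).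
* §4 `lambdaAdic.exists_resPi_eq_pow_nsmul`, `lambdaAdic.resPi_apply_eq_zero` — the engine: `f • x = 0` and
  `(1+X)^{p^n} = 1 + a f + p^k b` (lifting the exponent) give `res_{K_n→K_{n+k}} x_n = p^k •` (something), whose
  precision-`k` component vanishes.
* §5 `lambdaAdic.eq_zero_of_smul_eq_zero_of_shape` (`f = X^d v + p w`, `v` a unit), §6
  `lambdaAdic.eq_zero_of_smul_eq_zero` (`f ≠ 0`, `f • x = 0 ⇒ x = 0`), `lambdaAdic.smul_eq_zero_imp`
  (`f • x = 0 ⇒ f = 0 ∨ x = 0`).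
* §7 the compact signed Selmer modules: `selmerLambdaAdic.smul_eq_zero_imp_of_layers` (any `𝓛`, hypothesis
  `E(K_n)[p] = 0` for all `n`) and `selmerLambdaAdic.smul_eq_zero_imp` (hypothesis `E(K)[p] = 0` on the
  `K`-points of an elliptic curve over a number field, via `E(K_∞)[p^∞] = 0`,
  `LambdaAdicSelmerData.noPTorsion_layer`) — EXACTLY the shape
  `∀ 𝓛 f x, f • x = 0 → f = 0 ∨ x = 0` of the field `TransferInputs.torsionFree`.

METHOD. Verbatim transposition of the tree's proof for the classical pin (`LambdaAdicSelmerDataTorsionFreeProofs`,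
cell `bsd-print-x9`: Kato, Astérisque 295, Thm. 12.4 (2) made Shapiro-free) from `D : LambdaAdicSelmerData`
(levels `S_p(E/K_n)`) to the signed carrier `lambdaAdic` (levels `Sel^{𝓛}_{p^m}(E/K_n)`): the carrier's two
compatibilities (`p_*` and norm) and the levelwise action `X ↦ conj_γ − 1` are all that is used; the Selmer
CONDITIONS play no role (torsion-freeness is inherited by every `conj_γ`-stable subfamily). The hypothesis is
weakened from `E(K)[p] = 0` on an elliptic curve over a number field to the layerwise `E(K_n)[p] = 0` on any
Weierstrass curve over any field (what the proof uses), and specialised back in §7.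

PRINT. Castella–Wan 2024, proof of Thm. 6.8 (MS p. 30, via [PR00, §1.3.3] = Perrin-Riou, *Fonctions L
p-adiques des représentations p-adiques*, Astérisque 229 (1995), §1.3.3); Perrin-Riou 1987 §0 (the compact
modules); Castella–Grossi–Lee–Skinner 2022 §3.3 ("`T̄^{G_K} = 0` implies that `H¹_𝓕(K, T)` is
torsion-free"); Howard 2004, proof of Thm. 2.2.10. HONEST FRAMING: this proves ONE field of the six-field
hypothesis structure `TransferInputs` (whose existence is the refereed named fact
`castellaWan2024_proofThm68_transferInputs`); the other five fields (global duality (6.12)–(6.13), Lemma 6.7,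
the explicit reciprocity law Thm. 6.2, Cor. 6.4) are NOT addressed; the named fact is unchanged; BSD is not
proved by any of this; no summit statement is proved by this seat.

References: [CastellaWan2023] F. Castella, X. Wan, Math. Ann. 389 (2024), proof of Thm. 6.8 (MS p. 30);
[PerrinRiou1995Asterisque] §1.3.3; [PerrinRiou1987BSMF] §0 pp. 401–402; [CastellaGrossiLeeSkinner2022]
§3.3 proof of Thm. 3.3.1 (arXiv:2008.02571 p0017 L114); [Howard2004HeegnerKolyvagin] proof of Thm. 2.2.10;
[GreenbergLNM1716] §3 Lemma 3.1, §4 p. 109; [Washington1997] §7.1, §13.2–13.3; [Kato2004Asterisque]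
Thm. 12.4 (2) (the template).
-/

set_option autoImplicit false

noncomputable section

open scoped Classical

open WeierstrassCurve Literature.NumberTheory.EllipticCurves Literature.NumberTheory.GaloisRepresentations
  Literature.NumberTheory.EllipticCurves.IwasawaAlgebra PowerSeries Field

universe u

namespace Literature.NumberTheory.EllipticCurves.AcSigned

/-! ## §1 `E(K_n)[p] = 0` along the tower: no fixed `p`-power torsion, injective restriction -/

section Layers

variable {K : Type u} [Field K] {W : WeierstrassCurve K} {p : ℕ} [hp : Fact p.Prime]
  {κ : ZpExtension K p}

/-- **`E(K_n)[p] = 0 ⇒ E(K_n)[p^k] = 0`**: a geometric point fixed by `Gal(K̄/K_n)` and killed by `p^k`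
vanishes (induction on `k`: `p^{k-1} P` is fixed and killed by `p`).
[cite: GreenbergLNM1716, §4 p. 109 (E(F_∞)[p^∞] = 0 when E(F)[p] = 0)] -/
theorem geomPoints_eq_zero_of_forall_layer_fixed_of_pow_smul
    (hE : ∀ (n : ℕ) (P : geomPoints W), (∀ σ ∈ κ.layerSubgroup n, σ • P = P) → (p : ℤ) • P = 0 → P = 0)
    (n k : ℕ) (P : geomPoints W) (hfix : ∀ σ ∈ κ.layerSubgroup n, σ • P = P)
    (hk : ((p : ℤ) ^ k) • P = 0) : P = 0 := by
  induction k generalizing P with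
  | zero => simpa using hk
  | succ k ih =>
    -- `Q = p^k • P` is fixed and killed by `p`, hence `0`; then the induction hypothesis
    have hQfix : ∀ σ ∈ κ.layerSubgroup n, σ • (((p : ℤ) ^ k) • P) = ((p : ℤ) ^ k) • P := fun σ hσ ↦ by
      rw [smul_zsmul_geomPoints, hfix σ hσ]
    have hQ : ((p : ℤ) ^ k) • P = 0 := by
      refine hE n _ hQfix ?_
      rw [smul_smul, ← pow_succ', hk]
    exact ih P hfix hQ

/-- **`E[p^k]^{Gal(K̄/K_n)} = 0`** when `E(K_n)[p] = 0` (the `geomTorsion` form used by inflation–restriction).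
[cite: GreenbergLNM1716, §4 p. 109 (E(F_∞)[p^∞] = 0 when E(F)[p] = 0)] -/
theorem geomTorsion_eq_zero_of_forall_layer_fixed
    (hE : ∀ (n : ℕ) (P : geomPoints W), (∀ σ ∈ κ.layerSubgroup n, σ • P = P) → (p : ℤ) • P = 0 → P = 0)
    (n k : ℕ) (m : geomTorsion W ((p : ℤ) ^ k)) (hm : ∀ x ∈ κ.layerSubgroup n, x • m = m) : m = 0 := by
  have hm' : ∀ σ ∈ κ.layerSubgroup n, σ • (m : geomPoints W) = m := fun σ hσ ↦ by
    rw [← AddSubgroup.torsionBy.coe_smul, hm σ hσ]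
  exact Subtype.ext (geomPoints_eq_zero_of_forall_layer_fixed_of_pow_smul hE n k (m : geomPoints W) hm'
    ((mem_geomTorsion_iff W _ _).mp m.2))

/-- **Restriction `H¹(K_n, E[p^k]) → H¹(K_{n'}, E[p^k])` along the tower is injective** when `E(K_{n'})[p] = 0`
(inflation–restriction, `resOfLe_injective_of_forall_fixed_eq_zero`: the kernel lives on `E[p^k]^{Gal(K̄/K_{n'})} = 0`).
[cite: GreenbergLNM1716, §3 Lemma 3.1 (ker of restriction in a ℤ_p-tower) and §4 p. 109] -/
theorem resOfLe_layer_injective_of_forall_layer_fixed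
    (hE : ∀ (n : ℕ) (P : geomPoints W), (∀ σ ∈ κ.layerSubgroup n, σ • P = P) → (p : ℤ) • P = 0 → P = 0)
    {n n' : ℕ} (h : κ.layerSubgroup n' ≤ κ.layerSubgroup n) (k : ℕ) :
    Function.Injective (resOfLe (geomTorsion W ((p : ℤ) ^ k)) h) :=
  resOfLe_injective_of_forall_fixed_eq_zero h fun m hm ↦ geomTorsion_eq_zero_of_forall_layer_fixed hE n' k m hm

end Layers

/-! ## §2 The levelwise `Λ`-action on `lambdaAdic C`: `(1+X)^i ↦ conj_{γ^i}`, universal norms -/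

section LambdaAdic

variable {K : Type u} [Field K] {W : WeierstrassCurve K} {p : ℕ} [hp : Fact p.Prime]
  {κ : ZpExtension K p} {γ : absoluteGaloisGroup K}
  {C : ∀ n m : ℕ, AddSubgroup (W.torsionH1Over ((p : ℤ) ^ m) (κ.layerSubgroup n))}

/-- `X` acts as `conj_γ − 1` on every level `x_n ∈ ∏_m H¹(K_n, E[p^m])` (`lambdaAdic.X_smul_apply`,
all precisions at once). [cite: CastellaWan2023, §4.1 (MS p. 19, "Y = γ^ac − 1")] -/
theorem lambdaAdic.X_smul_apply_pi (hγ : κ.IsTopGenerator γ)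
    (hC : ∀ n m, ∀ y ∈ C n m, conjH1 (κ.layerSubgroup n) (geomTorsion W ((p : ℤ) ^ m)) γ y ∈ C n m)
    (x : lambdaAdic W p κ γ C) (n : ℕ) :
    (letI := lambdaAdic.moduleOfGen hγ hC; ((PowerSeries.X : IwasawaAlgebra p) • x).1 n) =
      W.conjPi p (κ.layerSubgroup n) γ (x.1 n) - x.1 n := by
  funext m
  rw [lambdaAdic.X_smul_apply hγ hC x n m, Pi.sub_apply]
  simp only [conjPi, AddMonoidHom.pi_apply, AddMonoidHom.coe_comp, Function.comp_apply,
    Pi.evalAddMonoidHom_apply]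

/-- **`(1 + X)^i` acts levelwise as `conj_{γ^i}`** on `lambdaAdic C` (`X ↦ conj_γ − 1`).
[cite: PerrinRiou1987BSMF, §0 p. 402 (𝔖_p as a ℤ_p⟦Gal⟧-module, γ ↦ 1 + T)] -/
theorem lambdaAdic.one_add_X_pow_smul_apply (hγ : κ.IsTopGenerator γ)
    (hC : ∀ n m, ∀ y ∈ C n m, conjH1 (κ.layerSubgroup n) (geomTorsion W ((p : ℤ) ^ m)) γ y ∈ C n m)
    (i n : ℕ) (x : lambdaAdic W p κ γ C) :
    (letI := lambdaAdic.moduleOfGen hγ hC; ((((1 : IwasawaAlgebra p) + PowerSeries.X) ^ i) • x).1 n) =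
      W.conjPi p (κ.layerSubgroup n) (γ ^ i) (x.1 n) := by
  letI := lambdaAdic.moduleOfGen hγ hC
  induction i generalizing x with
  | zero =>
    rw [pow_zero, one_smul, pow_zero]
    funext m
    simp only [conjPi, AddMonoidHom.pi_apply, AddMonoidHom.coe_comp, Function.comp_apply,
      Pi.evalAddMonoidHom_apply]
    rw [conjH1_one_holds, AddMonoidHom.id_apply]
  | succ i ih =>
    rw [pow_succ', mul_smul, add_smul, one_smul, AddSubgroup.coe_add, Pi.add_apply,
      lambdaAdic.X_smul_apply_pi hγ hC, ih, pow_succ', conjPi_mul]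
    abel

/-- **Universal norms** for `x ∈ lambdaAdic C` and layers `k ≤ k + n`:
`res_{K_k}^{K_{k+n}} x_k = Σ_{i<pⁿ} conj_{γ^{p^k i}} x_{k+n} = N_{K_{k+n}/K_k} x_{k+n}` (the `n`-fold iterate of the
carrier's norm compatibility; `Gal(K_{k+n}/K_k) = {γ^{p^k i}}_{i<pⁿ}`).
[cite: PerrinRiou1987BSMF, §0 p. 402 (res ∘ cor = N on 𝔖_p)] [cite: CastellaWan2023, (3.10) and §4.1 (MS pp. 14, 19)] -/
theorem lambdaAdic.resPi_eq_sum_conjPi (x : lambdaAdic W p κ γ C) (k n : ℕ) :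
    W.resPi p (κ.layerSubgroup_antitone (Nat.le_add_right k n)) (x.1 k) =
      ∑ i ∈ Finset.range (p ^ n), W.conjPi p (κ.layerSubgroup (k + n)) (γ ^ (p ^ k * i)) (x.1 (k + n)) := by
  induction n with
  | zero =>
    show W.resPi p (le_refl (κ.layerSubgroup k)) (x.1 k) =
      ∑ i ∈ Finset.range (p ^ 0), W.conjPi p (κ.layerSubgroup k) (γ ^ (p ^ k * i)) (x.1 k)
    rw [pow_zero, Finset.sum_range_one, mul_zero, pow_zero]
    funext m
    simp only [resPi, conjPi, AddMonoidHom.pi_apply, AddMonoidHom.coe_comp, Function.comp_apply,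
      Pi.evalAddMonoidHom_apply]
    rw [conjH1_one_holds, AddMonoidHom.id_apply, resOfLe_refl_holds, AddMonoidHom.id_apply]
  | succ n ih =>
    show W.resPi p (κ.layerSubgroup_antitone (Nat.le_add_right k (n + 1))) (x.1 k) =
      ∑ i ∈ Finset.range (p ^ (n + 1)), W.conjPi p (κ.layerSubgroup (k + n + 1)) (γ ^ (p ^ k * i))
        (x.1 (k + n + 1))
    have hstep : κ.layerSubgroup (k + n + 1) ≤ κ.layerSubgroup (k + n) := κ.layerSubgroup_antitone (Nat.le_succ _)
    rw [← W.resPi_resPi p _ hstep (κ.layerSubgroup_antitone (Nat.le_add_right k n)), ih,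
      W.resPi_sum_conjPi p _ hstep, x.2.2.2 (k + n), pow_succ p n,
      W.sum_range_mul_conjPi_pow p _ γ (p ^ n) p (p ^ k)]
    refine Finset.sum_congr rfl fun i _ ↦ ?_
    congr 1
    refine Finset.sum_congr rfl fun j _ ↦ ?_
    rw [← pow_add]

/-- **`(ν_{n,k} • x)_{n+k} = res_{K_n → K_{n+k}} x_n`** with `ν_{n,k} = Σ_{i<p^k} ((1+X)^{p^n})^i`: the universal-norm
identity in `Λ`-form (`resPi_eq_sum_conjPi` + `one_add_X_pow_smul_apply`).
[cite: PerrinRiou1987BSMF, §0 p. 402 (res ∘ cor = N on 𝔖_p)] [cite: Washington1997, §13.3 (ν_{n,m})] -/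
theorem lambdaAdic.geom_sum_smul_apply_eq_resPi (hγ : κ.IsTopGenerator γ)
    (hC : ∀ n m, ∀ y ∈ C n m, conjH1 (κ.layerSubgroup n) (geomTorsion W ((p : ℤ) ^ m)) γ y ∈ C n m)
    (n k : ℕ) (x : lambdaAdic W p κ γ C) :
    (letI := lambdaAdic.moduleOfGen hγ hC; ((∑ i ∈ Finset.range (p ^ k),
        (((1 : IwasawaAlgebra p) + PowerSeries.X) ^ p ^ n) ^ i) • x).1 (n + k)) =
      W.resPi p (κ.layerSubgroup_antitone (Nat.le_add_right n k)) (x.1 n) := by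
  letI := lambdaAdic.moduleOfGen hγ hC
  rw [lambdaAdic.resPi_eq_sum_conjPi x n k, Finset.sum_smul, AddSubgroup.val_finsetSum, Finset.sum_apply]
  refine Finset.sum_congr rfl fun i _ ↦ ?_
  rw [← pow_mul, lambdaAdic.one_add_X_pow_smul_apply hγ hC]

/-! ## §3 The `p`-part: `lambdaAdic C` has no `p`-torsion -/

/-- **`(p : Λ)^c • x = 0 ⇒ x = 0` in `lambdaAdic C`** when `E(K_n)[p] = 0` for all `n`: every level
`x_n ∈ ∏_m H¹(K_n, E[p^m])` is a `p_*`-compatible family killed by `p^c`, hence `0`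
(`eq_zero_of_pow_zsmul_eq_zero_of_reduce_eq`). [cite: PerrinRiou1987BSMF, §0 p. 401 (S_p(L) = lim← S(L)^{(p^k)})]
[cite: Howard2004HeegnerKolyvagin, §2.7 (E(K[n])[p] = 0)] -/
theorem lambdaAdic.eq_zero_of_pow_natCast_smul_eq_zero (hγ : κ.IsTopGenerator γ)
    (hC : ∀ n m, ∀ y ∈ C n m, conjH1 (κ.layerSubgroup n) (geomTorsion W ((p : ℤ) ^ m)) γ y ∈ C n m)
    (hE : ∀ (n : ℕ) (P : geomPoints W), (∀ σ ∈ κ.layerSubgroup n, σ • P = P) → (p : ℤ) • P = 0 → P = 0)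
    (c : ℕ) {x : lambdaAdic W p κ γ C}
    (hs : (letI := lambdaAdic.moduleOfGen hγ hC; ((p : IwasawaAlgebra p) ^ c) • x) = 0) : x = 0 := by
  letI := lambdaAdic.moduleOfGen hγ hC
  have h1 : ((p : IwasawaAlgebra p) ^ c) • x = (p ^ c : ℕ) • x := by
    rw [← Nat.cast_smul_eq_nsmul (IwasawaAlgebra p), Nat.cast_pow]
  rw [h1] at hs
  refine Subtype.ext (funext fun n ↦ ?_)
  have h2 : ((p : ℤ) ^ c) • x.1 n = 0 := by
    have h3 := congrArg (fun y : lambdaAdic W p κ γ C ↦ y.1 n) hs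
    simp only [AddSubgroup.coe_nsmul, Pi.smul_apply, AddSubgroup.coe_zero, Pi.zero_apply] at h3
    rwa [← natCast_zsmul, Nat.cast_pow] at h3
  rw [AddSubgroup.coe_zero, Pi.zero_apply]
  exact W.eq_zero_of_pow_zsmul_eq_zero_of_reduce_eq p (κ.layerSubgroup n) (hE n) c (x.1 n)
    (fun m ↦ x.2.2.1 n m) h2

/-! ## §4 The engine: lifting the exponent forces `p^k`-divisibility of `res x_n` -/

/-- **The engine.** If `f • x = 0` and `(1+X)^{p^n} = 1 + a f + p^k b` in `Λ`, then
`res_{K_n → K_{n+k}} x_n = p^k • z_{n+k}` for `z = x + (r b) • x`, where `ν_{n,k} = p^k + ω_n r`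
(`exists_geom_sum_eq`) and `ω_n • x = p^k (b • x)`.
[cite: Washington1997, §13.3 (Lemma 13.15: ν_{n,m} ≡ p^m mod ω_n) and §7.1]
[cite: Kato2004Asterisque, Thm. 12.4 (2) and §13.8 (the template argument)] -/
theorem lambdaAdic.exists_resPi_eq_pow_nsmul (hγ : κ.IsTopGenerator γ)
    (hC : ∀ n m, ∀ y ∈ C n m, conjH1 (κ.layerSubgroup n) (geomTorsion W ((p : ℤ) ^ m)) γ y ∈ C n m)
    {f : PowerSeries ℤ_[p]} {x : lambdaAdic W p κ γ C}
    (hs : (letI := lambdaAdic.moduleOfGen hγ hC; (f : IwasawaAlgebra p) • x) = 0)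
    {n k : ℕ} (hR : ∃ a b : PowerSeries ℤ_[p],
      (1 + PowerSeries.X) ^ p ^ n = 1 + a * f + (p : PowerSeries ℤ_[p]) ^ k * b) :
    ∃ z : lambdaAdic W p κ γ C, W.resPi p (κ.layerSubgroup_antitone (Nat.le_add_right n k)) (x.1 n) =
      (p ^ k) • z.1 (n + k) := by
  letI := lambdaAdic.moduleOfGen hγ hC
  obtain ⟨a, b, hab⟩ := hR
  obtain ⟨r, hr⟩ := exists_geom_sum_eq ((1 + PowerSeries.X : PowerSeries ℤ_[p]) ^ p ^ n) (p ^ k)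
  refine ⟨x + ((r * b : PowerSeries ℤ_[p]) : IwasawaAlgebra p) • x, ?_⟩
  have hω : ((((1 + PowerSeries.X : PowerSeries ℤ_[p]) ^ p ^ n - 1) * r : PowerSeries ℤ_[p]) :
      IwasawaAlgebra p) • x =
      (((p : PowerSeries ℤ_[p]) ^ k * (r * b) : PowerSeries ℤ_[p]) : IwasawaAlgebra p) • x := by
    rw [hab, show (1 + a * f + (p : PowerSeries ℤ_[p]) ^ k * b - 1) * r =
        (r * a) * f + (p : PowerSeries ℤ_[p]) ^ k * (r * b) by ring,
      add_smul, mul_smul, hs, smul_zero, zero_add]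
  have key : ((((p ^ k : ℕ) : PowerSeries ℤ_[p]) +
        ((1 + PowerSeries.X : PowerSeries ℤ_[p]) ^ p ^ n - 1) * r : PowerSeries ℤ_[p]) :
      IwasawaAlgebra p) • x = (p ^ k) • (x + ((r * b : PowerSeries ℤ_[p]) : IwasawaAlgebra p) • x) := by
    rw [add_smul, hω, ← Nat.cast_pow, mul_smul, Nat.cast_smul_eq_nsmul, Nat.cast_smul_eq_nsmul, smul_add]
  rw [← lambdaAdic.geom_sum_smul_apply_eq_resPi hγ hC n k x, hr, key, AddSubgroup.coe_nsmul, Pi.smul_apply]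

/-- **The precision-`j` component (`j ≤ k`) of `res_{K_n → K_{n+k}} x_n` vanishes** under the hypotheses of the
engine (`H¹(·, E[p^j])` is killed by `p^j ∣ p^k`). [cite: Kato2004Asterisque, Thm. 12.4 (2) and §13.8 (the template argument)]
[cite: Washington1997, §13.3 (Lemma 13.15)] -/
theorem lambdaAdic.resPi_apply_eq_zero (hγ : κ.IsTopGenerator γ)
    (hC : ∀ n m, ∀ y ∈ C n m, conjH1 (κ.layerSubgroup n) (geomTorsion W ((p : ℤ) ^ m)) γ y ∈ C n m)
    {f : PowerSeries ℤ_[p]} {x : lambdaAdic W p κ γ C}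
    (hs : (letI := lambdaAdic.moduleOfGen hγ hC; (f : IwasawaAlgebra p) • x) = 0)
    {n k : ℕ} (hR : ∃ a b : PowerSeries ℤ_[p],
      (1 + PowerSeries.X) ^ p ^ n = 1 + a * f + (p : PowerSeries ℤ_[p]) ^ k * b) {j : ℕ} (hjk : j ≤ k) :
    W.resPi p (κ.layerSubgroup_antitone (Nat.le_add_right n k)) (x.1 n) j = 0 := by
  obtain ⟨z, hz⟩ := lambdaAdic.exists_resPi_eq_pow_nsmul hγ hC hs hR
  rw [hz]
  exact WeierstrassCurve.LambdaAdicSelmerData.pow_nsmul_apply_eq_zero_of_le (V := W) (p := p) _ hjk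

/-! ## §5 Torsion-freeness for a power series in Weierstrass shape modulo `p` -/

/-- **`f = X^d · v + p · w` (`v ∈ Λˣ`), `f • x = 0 ⇒ x = 0`** in `lambdaAdic C`, when `E(K_n)[p] = 0` for all `n`
and `γ` is a topological generator. For a level `N` and a precision `k`: LIFTING THE EXPONENT gives `n ≥ N` with
`(1+X)^{p^n} = 1 + a f + p^k b` (`exists_one_add_X_pow_eq`); the `f`-torsion element `t = ν_{N,n−N} • x` has
`t_n = res_{K_N→K_n} x_N` (§2) and `res_{K_n→K_{n+k}} t_n` has vanishing precision-`k` component (§4);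
restriction being injective on `H¹(K_·, E[p^k])` along the tower (§1), `(x_N)_k = 0`.
[cite: CastellaGrossiLeeSkinner2022, §3.3 proof of Thm. 3.3.1 (arXiv:2008.02571 p0017 L114: "T̄^{G_K} = 0 implies H¹_𝓕(K,T) torsion-free")]
[cite: Kato2004Asterisque, Thm. 12.4 (2) and §13.8 (the template argument)] -/
theorem lambdaAdic.eq_zero_of_smul_eq_zero_of_shape (hγ : κ.IsTopGenerator γ)
    (hC : ∀ n m, ∀ y ∈ C n m, conjH1 (κ.layerSubgroup n) (geomTorsion W ((p : ℤ) ^ m)) γ y ∈ C n m)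
    (hE : ∀ (n : ℕ) (P : geomPoints W), (∀ σ ∈ κ.layerSubgroup n, σ • P = P) → (p : ℤ) • P = 0 → P = 0)
    {f v w : PowerSeries ℤ_[p]} {d : ℕ} (hv : IsUnit v)
    (hf : f = PowerSeries.X ^ d * v + (p : PowerSeries ℤ_[p]) * w) {x : lambdaAdic W p κ γ C}
    (hs : (letI := lambdaAdic.moduleOfGen hγ hC; (f : IwasawaAlgebra p) • x) = 0) : x = 0 := by
  letI := lambdaAdic.moduleOfGen hγ hC
  refine Subtype.ext (funext fun N ↦ funext fun k ↦ ?_)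
  obtain ⟨n, hNn, hR⟩ := exists_one_add_X_pow_eq p hv hf k N
  obtain ⟨j, rfl⟩ := Nat.exists_eq_add_of_le hNn
  -- the `f`-torsion element `t = ν_{N,j} • x`, with `t_{N+j} = res x_N`
  set t : lambdaAdic W p κ γ C := (∑ i ∈ Finset.range (p ^ j),
      (((1 : IwasawaAlgebra p) + PowerSeries.X) ^ p ^ N) ^ i) • x with ht
  have hts : (f : IwasawaAlgebra p) • t = 0 := by rw [ht, smul_comm, hs, smul_zero]
  -- precision-`k` component of `res_{K_{N+j} → K_{N+j+k}} t_{N+j}` vanishes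
  have h1 : W.resPi p (κ.layerSubgroup_antitone (Nat.le_add_right (N + j) k)) (t.1 (N + j)) k = 0 :=
    lambdaAdic.resPi_apply_eq_zero hγ hC hts hR le_rfl
  -- hence `(t_{N+j})_k = 0` by injectivity of restriction
  have h2 : t.1 (N + j) k = 0 := by
    rw [WeierstrassCurve.LambdaAdicSelmerData.resPi_apply] at h1
    exact resOfLe_layer_injective_of_forall_layer_fixed hE _ k (by rw [h1, map_zero])
  -- `t_{N+j} = res x_N`, and restriction is injective again
  have h3 : W.resPi p (κ.layerSubgroup_antitone (Nat.le_add_right N j)) (x.1 N) k = 0 := by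
    rw [← lambdaAdic.geom_sum_smul_apply_eq_resPi hγ hC N j x, ← ht, h2]
  rw [WeierstrassCurve.LambdaAdicSelmerData.resPi_apply] at h3
  rw [AddSubgroup.coe_zero, Pi.zero_apply, Pi.zero_apply]
  exact resOfLe_layer_injective_of_forall_layer_fixed hE _ k (by rw [h3, map_zero])

/-! ## §6 `lambdaAdic C` is `Λ`-torsion-free -/

/-- **`lambdaAdic C` is a torsion-free `Λ`-module** when `E(K_n)[p] = 0` along the tower and `γ` is a
topological generator: `f ≠ 0`, `f • x = 0 ⇒ x = 0`. Proof: `f = p^m f′` with a coefficient of `f′` prime to `p`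
(`exists_eq_pow_mul_of_ne_zero`), `f′ • x = 0` by the `p`-part (§3), `f′ = X^d v + p w`
(`exists_eq_X_pow_mul_add_mul`), and §5. Printed: CGLS22 §3.3 "The assumption `T̄^{G_K} = 0` implies that
`H¹_𝓕(K, T)` is torsion-free"; Castella–Wan, proof of Thm. 6.8 via [PR00, §1.3.3].
[cite: CastellaGrossiLeeSkinner2022, §3.3 proof of Thm. 3.3.1 (arXiv:2008.02571 p0017 L114)]
[cite: CastellaWan2023, proof of Thm. 6.8 (MS p. 30)] -/
theorem lambdaAdic.eq_zero_of_smul_eq_zero (hγ : κ.IsTopGenerator γ)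
    (hC : ∀ n m, ∀ y ∈ C n m, conjH1 (κ.layerSubgroup n) (geomTorsion W ((p : ℤ) ^ m)) γ y ∈ C n m)
    (hE : ∀ (n : ℕ) (P : geomPoints W), (∀ σ ∈ κ.layerSubgroup n, σ • P = P) → (p : ℤ) • P = 0 → P = 0)
    {f : IwasawaAlgebra p} (hf : f ≠ 0) {x : lambdaAdic W p κ γ C}
    (hs : (letI := lambdaAdic.moduleOfGen hγ hC; f • x) = 0) : x = 0 := by
  letI := lambdaAdic.moduleOfGen hγ hC
  obtain ⟨m, f', rfl, hf'⟩ := exists_eq_pow_mul_of_ne_zero p hf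
  obtain ⟨d, v, w, hv, hf'eq⟩ := exists_eq_X_pow_mul_add_mul p hf'
  have hs' : (f' : IwasawaAlgebra p) • x = 0 := by
    refine lambdaAdic.eq_zero_of_pow_natCast_smul_eq_zero hγ hC hE m ?_
    rw [← mul_smul]
    exact hs
  exact lambdaAdic.eq_zero_of_smul_eq_zero_of_shape hγ hC hE hv hf'eq hs'

/-- **No zero smul-divisors: `f • x = 0 ⇒ f = 0 ∨ x = 0`** on `lambdaAdic C` (`E(K_n)[p] = 0` along the tower,
`γ` a topological generator) — the shape of the field `TransferInputs.torsionFree`.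
[cite: CastellaWan2023, proof of Thm. 6.8 (MS p. 30: "the Λ^ac-torsion submodule of H¹(K, 𝐓^ac) is trivial")]
[cite: PerrinRiou1995Asterisque, §1.3.3] -/
theorem lambdaAdic.smul_eq_zero_imp (hγ : κ.IsTopGenerator γ)
    (hC : ∀ n m, ∀ y ∈ C n m, conjH1 (κ.layerSubgroup n) (geomTorsion W ((p : ℤ) ^ m)) γ y ∈ C n m)
    (hE : ∀ (n : ℕ) (P : geomPoints W), (∀ σ ∈ κ.layerSubgroup n, σ • P = P) → (p : ℤ) • P = 0 → P = 0)
    (f : IwasawaAlgebra p) (x : lambdaAdic W p κ γ C)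
    (h : (letI := lambdaAdic.moduleOfGen hγ hC; f • x) = 0) : f = 0 ∨ x = 0 :=
  or_iff_not_imp_left.mpr fun hf ↦ lambdaAdic.eq_zero_of_smul_eq_zero hγ hC hE hf h

/-- **`NoZeroSMulDivisors Λ (lambdaAdic C)`** for the structure `lambdaAdic.moduleOfGen hγ hC`
(`E(K_n)[p] = 0` along the tower). [cite: CastellaWan2023, proof of Thm. 6.8 (MS p. 30)] [cite: PerrinRiou1995Asterisque, §1.3.3] -/
theorem lambdaAdic.noZeroSMulDivisors (hγ : κ.IsTopGenerator γ)
    (hC : ∀ n m, ∀ y ∈ C n m, conjH1 (κ.layerSubgroup n) (geomTorsion W ((p : ℤ) ^ m)) γ y ∈ C n m)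
    (hE : ∀ (n : ℕ) (P : geomPoints W), (∀ σ ∈ κ.layerSubgroup n, σ • P = P) → (p : ℤ) • P = 0 → P = 0) :
    letI := lambdaAdic.moduleOfGen hγ hC
    NoZeroSMulDivisors (IwasawaAlgebra p) (lambdaAdic W p κ γ C) := by
  letI := lambdaAdic.moduleOfGen hγ hC
  exact ⟨fun {f x} h ↦ lambdaAdic.smul_eq_zero_imp hγ hC hE f x h⟩

end LambdaAdic

/-! ## §7 The compact signed Selmer modules `Sel^{𝓛}(K, 𝐓^ac)` -/

section SelmerLambdaAdic

variable {K : Type u} [Field K] [NumberField K] {W : WeierstrassCurve K} {p : ℕ} [hp : Fact p.Prime]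
  {κ : ZpExtension K p} {γ : absoluteGaloisGroup K}

/-- **`Sel^{𝓛}(K, 𝐓^ac)` has no zero smul-divisors** — `f • x = 0 ⇒ f = 0 ∨ x = 0` for every family of local
conditions `𝓛` — when `E(K_n)[p] = 0` at every layer of the `ℤ_p`-extension and `γ` is a topological generator
(structure `selmerLambdaAdic.moduleOfGen`). [cite: CastellaWan2023, proof of Thm. 6.8 (MS p. 30)]
[cite: PerrinRiou1995Asterisque, §1.3.3] -/
theorem selmerLambdaAdic.smul_eq_zero_imp_of_layers (hγ : κ.IsTopGenerator γ)
    (hE : ∀ (n : ℕ) (P : geomPoints W), (∀ σ ∈ κ.layerSubgroup n, σ • P = P) → (p : ℤ) • P = 0 → P = 0)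
    (L : IsDedekindDomain.HeightOneSpectrum (NumberField.RingOfIntegers K) → PCond) (f : IwasawaAlgebra p)
    (x : selmerLambdaAdic W p κ γ L)
    (h : (letI := selmerLambdaAdic.moduleOfGen W p κ γ hγ L; f • x) = 0) : f = 0 ∨ x = 0 :=
  lambdaAdic.smul_eq_zero_imp (C := fun n m ↦ selmerTorsion W p κ L n m) hγ
    (fun _ _ _ hy ↦ conjH1_mem_selmerTorsion γ hy) hE f x h

/-- **`Sel^{𝓛}(K, 𝐓^ac)` has no zero smul-divisors when `E(K)[p] = 0`** (`E = W/K` an elliptic curve over a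
number field, hypothesis on the `K`-points: `p • P = 0 ⇒ P = 0`): then `E(K_∞)[p^∞] = 0`
(`LambdaAdicSelmerData.noPTorsion_layer`, as `Gal(K_∞/K)` is pro-`p`), and the layerwise form applies. For
`𝓛 ≡ sgn ε` this is Castella–Wan's "`E(K)[p] = 0` … hence … the `Λ^ac`-torsion submodule of `H¹(K, 𝐓^ac)` is
trivial" — the field `TransferInputs.torsionFree`, for every `𝓛` at once.
[cite: CastellaWan2023, proof of Thm. 6.8 (MS p. 30)] [cite: PerrinRiou1995Asterisque, §1.3.3]
[cite: GreenbergLNM1716, §4 p. 109 (E(F_∞)[p^∞] = 0 when E(F)[p] = 0)] -/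
theorem selmerLambdaAdic.smul_eq_zero_imp [W.IsElliptic] (hγ : κ.IsTopGenerator γ)
    (hK : ∀ P : W.toAffine.Point, p • P = 0 → P = 0)
    (L : IsDedekindDomain.HeightOneSpectrum (NumberField.RingOfIntegers K) → PCond) (f : IwasawaAlgebra p)
    (x : selmerLambdaAdic W p κ γ L)
    (h : (letI := selmerLambdaAdic.moduleOfGen W p κ γ hγ L; f • x) = 0) : f = 0 ∨ x = 0 :=
  selmerLambdaAdic.smul_eq_zero_imp_of_layers hγ
    (fun n ↦ WeierstrassCurve.LambdaAdicSelmerData.noPTorsion_layer κ hK n) L f x h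

/-- **Torsion-freeness in the `f • x = 0 → f = 0 ∨ x = 0` form of `TransferInputs.torsionFree`, all `𝓛` at once**
(`E(K)[p] = 0`). [cite: CastellaWan2023, proof of Thm. 6.8 (MS p. 30)] [cite: PerrinRiou1995Asterisque, §1.3.3] -/
theorem selmerLambdaAdic.forall_smul_eq_zero_imp [W.IsElliptic] (hγ : κ.IsTopGenerator γ)
    (hK : ∀ P : W.toAffine.Point, p • P = 0 → P = 0) :
    ∀ (L : IsDedekindDomain.HeightOneSpectrum (NumberField.RingOfIntegers K) → PCond) (f : IwasawaAlgebra p)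
      (x : selmerLambdaAdic W p κ γ L),
      (letI := selmerLambdaAdic.moduleOfGen W p κ γ hγ L; f • x) = 0 → f = 0 ∨ x = 0 :=
  fun L f x h ↦ selmerLambdaAdic.smul_eq_zero_imp hγ hK L f x h

end SelmerLambdaAdic

end Literature.NumberTheory.EllipticCurves.AcSigned

end
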